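import Summits.BirchSwinnertonDyer.BirchSwinnertonDyer.Theses.ResidualThetaTransportAtTwo
import Summits.BirchSwinnertonDyer.BirchSwinnertonDyer.Theorems.ResidualThetaTransportAtTwoThetaLayerLambdaCongruenceAtTwoNoMazurKenku
import Summits.BirchSwinnertonDyer.BirchSwinnertonDyer.Theorems.ResidualThetaTransportAtTwoSignedMuVanishingAtTwoPlusCuspSpanNamed
import HarnessLib

/-!
# Route `ResidualThetaTransportAtTwo`, glue item stmt-BirchSwinnertonDyer-27454 `ThetaLayerLambdaCongruenceAtTwoGlue`:
# the split children imply the parent — `PublishedInputsHeckeAtTwo → CuspSpanEvenAtTwoOdd → ThetaLayerLambdaCongruenceAtTwo`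

Cell `bsd-wall`, width seat `bsd-wall-rtt-p3-w3` g6. The glue of the W8′ split of Kan⁺ (route rev 33, pen bsd-wall-p2 g16): the five
published Hecke-side inputs PUB⁵ = {Eichler–Shimura depleted optimal quotient, Hecke self-duality of `J₀[2]`, Buzzard 2000 Prop. 2.4,
Serre 1972 Prop. 12, Abbes–Ullmo Thm. A} together with the curve-free node «`CuspSpanEvenAtTwo N` for every odd `N`» (inlined in the
route file) give the crux `ThetaLayerLambdaCongruenceAtTwo` BY NAME, through the landed closers
`ThetaLayerLambdaCongruenceAtTwo.kanP5_of_pub_of_signedMuAnalyticAtTwoPlus` (p618708, w3 g5) and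
`SignedMuAtTwo.signedMuAnalyticAtTwoPlus_of_abbesUllmo_of_forall_cuspSpanEvenAtTwo` (rtt-p4). This is the pen's certified term
(`cert/W8fctxRTT.lean`). The node itself (item 27436) is conjecture-grade and OPEN; BSD is not proved by this.
-/

set_option autoImplicit false
-- justification: the `Summit.BirchSwinnertonDyer.BirchSwinnertonDyer.…` path repeats a component (route-file convention)
set_option linter.dupNamespace false

namespace Summit.BirchSwinnertonDyer.BirchSwinnertonDyer.Theorems

/-- **Glue (item 27454)**: `PublishedInputsHeckeAtTwo → CuspSpanEvenAtTwoOdd → ThetaLayerLambdaCongruenceAtTwo` — the five print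
facts and the node at every odd level give Kan⁺ by name (`kanP5_of_pub_of_signedMuAnalyticAtTwoPlus` fed with the analytic child
obtained from Abbes–Ullmo and the node). [cite: AbbesUllmo1996, Thm. A] [cite: Pollack2003, Conj. 6.3 and Prop. 6.18 (shape)] -/
theorem ThetaLayerLambdaCongruenceAtTwoGlue_proof :
    Summit.BirchSwinnertonDyer.BirchSwinnertonDyer.Theses.ResidualThetaTransportAtTwo.ThetaLayerLambdaCongruenceAtTwoGlue := by
  unfold Summit.BirchSwinnertonDyer.BirchSwinnertonDyer.Theses.ResidualThetaTransportAtTwo.ThetaLayerLambdaCongruenceAtTwoGlue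
  rintro ⟨hES, hSD, hBz, hSe, hAU⟩ hG
  exact ThetaLayerLambdaCongruenceAtTwo.kanP5_of_pub_of_signedMuAnalyticAtTwoPlus hES hSD hBz hSe hAU
    (SignedMuAtTwo.signedMuAnalyticAtTwoPlus_of_abbesUllmo_of_forall_cuspSpanEvenAtTwo hAU fun N _ hN ↦ hG N hN)

end Summit.BirchSwinnertonDyer.BirchSwinnertonDyer.Theorems
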